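import Summits.SmoothPoincare4.SmoothPoincare4.Theorems.EntropyRungConicalGapStubWeightedIdentity
import Summits.SmoothPoincare4.SmoothPoincare4.Theorems.EntropyRungConicalGapStubWeightedIntegrability
import HarnessLib

/-!
# Helpers `helper_secondWeightedIdentity`, `helper_varianceIdentity` of line `Sketch`
(crux `EntropyRung.ConicalGap`, stmt-SmoothPoincare4-16589)

Wang–Wang 2023 (arXiv:2308.06560, proof of Prop. 2.6), `n = 4`, second moment: on a complete
connected normalised gradient shrinking Ricci soliton `(M⁴, g, f)` (`Ric + Hess f = g/2`,
`R + |∇f|² = f`, closed `g`-balls compact), for every `τ > 0`, writing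
`Z = ∫ e^{-f/τ}`, `F₁ = ∫ f e^{-f/τ}`, `F₂ = ∫ f² e^{-f/τ}`, `R₁ = ∫ R e^{-f/τ}`, `FR = ∫ f R e^{-f/τ}`
(all w.r.t. `dV`):

* the weights `f² e^{-f/τ}` and `f R e^{-f/τ}` are integrable
  (`secondWeightedIdentity_integrable`: `t e^{-t/(2τ)} ≤ 2τ` for `t ≥ 0`, so
  `f² e^{-f/τ} ≤ 2τ · f e^{-f/(2τ)}`, integrable by `weightedIntegrability_riemVolume` at `2τ`;
  and `0 ≤ R ≤ f`);
* **the second weighted identity** `F₂ = 3τ F₁ + (1 − τ) FR − τ R₁`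
  (`secondWeightedIdentity_riemVolume`): the cut-off Green identity `∫ Δ_g(f e^{-f/τ}) dV = 0`
  (`CarrilloNi2009_shrinkerLSI.integral_dalembertian_eq_zero_of_proper`) for the weight
  `ζ ∘ f`, `ζ(t) = t e^{-t/τ}`, `ζ′(t) = e^{-t/τ}(1 − t/τ)`, `ζ″(t) = −τ⁻¹ e^{-t/τ}(2 − t/τ)`,
  via the chain rule `Δ(ζ ∘ f) = ζ″(f)|∇f|² + ζ′(f) Δf` (`dalembertian_real_comp`) with
  `|∇f|² = f − R`, `Δf = 2 − R` (`CarrilloNi2009_shrinkerLSI.scalarCurvature_add_dalembertian`):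
  `τ² Δ(f e^{-f/τ}) = (f² + (τ − 1) f R − 4τ f + (2τ − τ²) R + 2τ²) e^{-f/τ}`, combined with the
  first weighted identity `F₁ − 2τ Z = (1 − τ) R₁` (`weightedIdentity_riemVolume`);
* **the variance identity** `Z F₂ − F₁² = 2τ² Z² − τ² R₁ Z + (1 − τ)(Z FR − F₁ R₁)`, the linear
  combination `Z · (second) + (τ Z − F₁) · (first)` of the two identities.

Everything here is proved; no definition and no named fact is introduced.

## References

* Y. Wang, G. Wang (Wang–Wang 2023), arXiv:2308.06560, Prop. 2.6, (2.7)–(2.10).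
* [CarrilloNi2009] J. Carrillo, L. Ni, Comm. Anal. Geom. 17 (2009) 721–753, §2 (2.1)–(2.3), §4.
-/

noncomputable section

-- `Summit.SmoothPoincare4.SmoothPoincare4.…` (summit = problem) trips `dupNamespace` on every decl.
set_option linter.dupNamespace false

open scoped Manifold ContDiff ENNReal NNReal Topology
open MeasureTheory Set Filter
open Literature.Geometry.Lorentzian Literature.Geometry.Riemannian

namespace Summit.SmoothPoincare4.SmoothPoincare4.Theorems.ConicalGapSketch

/-! ## The weight `ζ(t) = t e^{-t/τ}` on the real line -/

/-- `ζ(t) = t e^{-t/τ}` has derivative `ζ′(t) = e^{-t/τ} (1 − t/τ)`. -/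
theorem secondWeightedIdentity_hasDerivAt (τ t : ℝ) :
    HasDerivAt (fun s : ℝ ↦ s * Real.exp (-s / τ)) (Real.exp (-t / τ) * (1 - t / τ)) t :=
  ((hasDerivAt_id' t).mul (weightedIdentity_hasDerivAt_expNegDiv τ t)).congr_deriv (by ring)

/-- `ζ′ = e^{-·/τ} (1 − ·/τ)` as functions. -/
theorem secondWeightedIdentity_deriv (τ : ℝ) :
    deriv (fun s : ℝ ↦ s * Real.exp (-s / τ)) = fun t ↦ Real.exp (-t / τ) * (1 - t / τ) :=
  funext fun t ↦ (secondWeightedIdentity_hasDerivAt τ t).deriv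

/-- `(e^{-·/τ} (1 − ·/τ))′(t) = e^{-t/τ} (−1/τ) (2 − t/τ)`. -/
theorem secondWeightedIdentity_hasDerivAt_deriv (τ t : ℝ) :
    HasDerivAt (fun s : ℝ ↦ Real.exp (-s / τ) * (1 - s / τ))
      (Real.exp (-t / τ) * (-1 / τ) * (2 - t / τ)) t := by
  have h2 : HasDerivAt (fun s : ℝ ↦ 1 - s / τ) (0 - 1 / τ) t :=
    (hasDerivAt_const t 1).sub ((hasDerivAt_id' t).div_const τ)
  exact ((weightedIdentity_hasDerivAt_expNegDiv τ t).mul h2).congr_deriv (by ring)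

/-- `ζ″(t) = e^{-t/τ} (−1/τ) (2 − t/τ)`. -/
theorem secondWeightedIdentity_deriv_deriv (τ t : ℝ) :
    deriv (deriv fun s : ℝ ↦ s * Real.exp (-s / τ)) t =
      Real.exp (-t / τ) * (-1 / τ) * (2 - t / τ) := by
  rw [secondWeightedIdentity_deriv]
  exact (secondWeightedIdentity_hasDerivAt_deriv τ t).deriv

/-- The elementary bound `t e^{-t/(2τ)} ≤ 2τ` for `t ≥ 0`, `τ > 0` (from `1 + s ≤ e^s`). -/
theorem secondWeightedIdentity_mul_exp_le {τ t : ℝ} (hτ : 0 < τ) (ht : 0 ≤ t) :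
    t * Real.exp (-t / (2 * τ)) ≤ 2 * τ := by
  have h1 : t / (2 * τ) ≤ Real.exp (t / (2 * τ)) := by
    linarith [Real.add_one_le_exp (t / (2 * τ))]
  rw [div_le_iff₀ (by positivity)] at h1
  have h2 : Real.exp (t / (2 * τ)) * Real.exp (-t / (2 * τ)) = 1 := by
    rw [neg_div, ← Real.exp_add, add_neg_cancel, Real.exp_zero]
  have h3 : 0 ≤ t * Real.exp (-t / (2 * τ)) := mul_nonneg ht (Real.exp_pos _).le
  calc t * Real.exp (-t / (2 * τ))
      ≤ Real.exp (t / (2 * τ)) * (2 * τ) * Real.exp (-t / (2 * τ)) :=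
        mul_le_mul_of_nonneg_right h1 (Real.exp_pos _).le
    _ = 2 * τ := by rw [mul_right_comm, h2, one_mul]

/-! ## Pointwise identities on a normalised gradient shrinker (any dimension) -/

section Pointwise

variable {n : ℕ} {M : Type*} [TopologicalSpace M] [ChartedSpace (EuclideanSpace ℝ (Fin n)) M]
  [IsManifold (𝓡 n) ∞ M]
  {g : PseudoRiemannianMetric (𝓡 n) ∞ (EuclideanSpace ℝ (Fin n)) (TangentSpace (𝓡 n) : M → Type _)}
  {f : M → ℝ}

/-- `d(f e^{-f/τ}) = e^{-f/τ}(1 − f/τ) df` inside the inverse metric: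
`g⁻¹(dρ, d(f e^{-f/τ})) = e^{-f/τ} (1 − f/τ) g⁻¹(dρ, df)` (chain rule `mvfderiv_real_comp_apply`). -/
theorem secondWeightedIdentity_innerDual_mvfderiv (τ : ℝ) {ρ : M → ℝ} {x : M}
    (hfx : MDifferentiableAt (𝓡 n) 𝓘(ℝ, ℝ) f x) :
    g.innerDual x (mvfderiv (𝓡 n) ρ x).toLinearMap
        (mvfderiv (𝓡 n) (fun y ↦ f y * Real.exp (-f y / τ)) x).toLinearMap =
      Real.exp (-f x / τ) * (1 - f x / τ) *
        g.innerDual x (mvfderiv (𝓡 n) ρ x).toLinearMap (mvfderiv (𝓡 n) f x).toLinearMap := by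
  have hd := secondWeightedIdentity_hasDerivAt τ (f x)
  have hlin : (mvfderiv (𝓡 n) (fun y ↦ f y * Real.exp (-f y / τ)) x).toLinearMap =
      (Real.exp (-f x / τ) * (1 - f x / τ)) • (mvfderiv (𝓡 n) f x).toLinearMap := by
    ext v
    have := mvfderiv_real_comp_apply (I := 𝓡 n) hd hfx v
    simpa [Function.comp_def] using this
  rw [hlin]
  simp only [PseudoRiemannianMetric.innerDual, map_smul, smul_eq_mul]

variable [g.HasLeviCivita]

/-- **`Δ(f e^{-f/τ}) = −τ⁻¹ e^{-f/τ} (2 − f/τ)(f − R) + e^{-f/τ} (1 − f/τ)(n/2 − R)`** on a gradient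
shrinker `Ric + Hess f = g/2` normalised by `R + |∇f|² = f` (Wang–Wang 2023, second moment of the
computation behind (2.9)): the chain rule `Δ(ζ ∘ f) = ζ″(f)|∇f|² + ζ′(f) Δf`
(`dalembertian_real_comp`) with `ζ(t) = t e^{-t/τ}`, `|∇f|² = f − R` and `Δf = n/2 − R`
(`scalarCurvature_add_dalembertian`). -/
theorem secondWeightedIdentity_dalembertian
    (hsol : ∀ (x : M) (X Y : TangentSpace (𝓡 n) x),
      g.ricci x X Y + g.hessian f x X Y = (1 / 2 : ℝ) * g.val x X Y)
    (hnorm : ∀ x : M, g.scalarCurvature x + g.gradSq f x = f x)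
    (hf : ContMDiff (𝓡 n) 𝓘(ℝ, ℝ) ∞ f) (τ : ℝ) (x : M) :
    g.dalembertian (fun y ↦ f y * Real.exp (-f y / τ)) x =
      Real.exp (-f x / τ) * (-1 / τ) * (2 - f x / τ) * (f x - g.scalarCurvature x) +
        Real.exp (-f x / τ) * (1 - f x / τ) * (n / 2 - g.scalarCurvature x) := by
  have hfx : ContMDiffAt (𝓡 n) 𝓘(ℝ, ℝ) 2 f x := (hf.of_le ENat.LEInfty.out).contMDiffAt
  have hζ : ContDiffAt ℝ 2 (fun t : ℝ ↦ t * Real.exp (-t / τ)) (f x) :=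
    (contDiff_id.mul (Real.contDiff_exp.comp (contDiff_neg.div_const τ))).contDiffAt
  have hcomp := g.dalembertian_real_comp (ζ := fun t : ℝ ↦ t * Real.exp (-t / τ)) hfx hζ
  rw [show (fun y ↦ f y * Real.exp (-f y / τ)) = (fun t : ℝ ↦ t * Real.exp (-t / τ)) ∘ f from rfl,
    hcomp, secondWeightedIdentity_deriv_deriv, (secondWeightedIdentity_hasDerivAt τ (f x)).deriv]
  have hgrad : g.innerDual x (mvfderiv (𝓡 n) f x).toLinearMap (mvfderiv (𝓡 n) f x).toLinearMap =
      g.gradSq f x := rfl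
  rw [hgrad]
  have h1 := CarrilloNi2009_shrinkerLSI.scalarCurvature_add_dalembertian hsol x
  have h2 := hnorm x
  have h3 : g.gradSq f x = f x - g.scalarCurvature x := by linarith
  have h4 : g.dalembertian f x = n / 2 - g.scalarCurvature x := by linarith
  rw [h3, h4]

end Pointwise

/-! ## Integrability of the second-moment weights (any dimension) -/

section ProperIntegrability

variable {n : ℕ} {M : Type*} [TopologicalSpace M] [ChartedSpace (EuclideanSpace ℝ (Fin n)) M]
  [IsManifold (𝓡 n) ∞ M] [T3Space M] [MeasurableSpace M] [BorelSpace M]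
  {g : PseudoRiemannianMetric (𝓡 n) ∞ (EuclideanSpace ℝ (Fin n)) (TangentSpace (𝓡 n) : M → Type _)}
  {f : M → ℝ} [g.HasLeviCivita]

/-- **`f² e^{-f/τ}` and `f R e^{-f/τ}` are integrable for every `τ > 0`** on a gradient shrinker with
proper potential and `R ≥ 0` (Wang–Wang 2023, Prop. 2.6, quadratic growth of `f`), over
`g.riemVolume`: `f² e^{-f/τ} = (f e^{-f/(2τ)})² ≤ 2τ · f e^{-f/(2τ)}`
(`secondWeightedIdentity_mul_exp_le`), integrable by `weightedIntegrability_riemVolume` at `2τ`;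
and `0 ≤ f R e^{-f/τ} ≤ f² e^{-f/τ}` since `0 ≤ R ≤ f` (`R + |∇f|² = f`, `|∇f|² ≥ 0`). -/
theorem secondWeightedIdentity_integrable (hg : g.IsRiemannian)
    (hf : ContMDiff (𝓡 n) 𝓘(ℝ, ℝ) ∞ f)
    (hsol : ∀ (x : M) (X Y : TangentSpace (𝓡 n) x),
      g.ricci x X Y + g.hessian f x X Y = (1 / 2 : ℝ) * g.val x X Y)
    (hnorm : ∀ x : M, g.scalarCurvature x + g.gradSq f x = f x)
    (hprop : ∀ R : ℝ, IsCompact {x | f x ≤ R}) (hR0 : ∀ x, 0 ≤ g.scalarCurvature x) {τ : ℝ}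
    (hτ : 0 < τ) :
    Integrable (fun x ↦ f x ^ 2 * Real.exp (-f x / τ)) g.riemVolume ∧
      Integrable (fun x ↦ f x * g.scalarCurvature x * Real.exp (-f x / τ)) g.riemVolume := by
  have hf0 : ∀ x, 0 ≤ f x := fun x ↦ by linarith [hnorm x, hR0 x, g.gradSq_nonneg hg f x]
  have hRle : ∀ x, g.scalarCurvature x ≤ f x := fun x ↦ by
    linarith [hnorm x, g.gradSq_nonneg hg f x]
  obtain ⟨-, iF2, -⟩ :=
    weightedIntegrability_riemVolume hg hf hsol hnorm hprop hR0 (τ := 2 * τ) (by positivity)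
  have hE : Continuous fun x ↦ Real.exp (-f x / τ) :=
    Real.continuous_exp.comp (hf.continuous.neg.div_const _)
  have hSc : Continuous fun x ↦ g.scalarCurvature x :=
    (PseudoRiemannianMetric.contMDiff_scalarCurvature g).continuous
  -- `e^{-f/τ} = e^{-f/(2τ)} · e^{-f/(2τ)}`
  have hsq : ∀ x, Real.exp (-f x / τ) = Real.exp (-f x / (2 * τ)) * Real.exp (-f x / (2 * τ)) :=
    fun x ↦ by
    rw [← Real.exp_add]
    congr 1
    field_simp
    ring
  have iA : Integrable (fun x ↦ f x ^ 2 * Real.exp (-f x / τ)) g.riemVolume := by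
    refine (iF2.const_mul (2 * τ)).mono' ((hf.continuous.pow 2).mul hE).aestronglyMeasurable
      (Eventually.of_forall fun x ↦ ?_)
    rw [Real.norm_eq_abs, abs_of_nonneg (mul_nonneg (sq_nonneg _) (Real.exp_pos _).le), hsq x]
    have h0 : 0 ≤ f x * Real.exp (-f x / (2 * τ)) := mul_nonneg (hf0 x) (Real.exp_pos _).le
    calc f x ^ 2 * (Real.exp (-f x / (2 * τ)) * Real.exp (-f x / (2 * τ)))
        = (f x * Real.exp (-f x / (2 * τ))) * (f x * Real.exp (-f x / (2 * τ))) := by ring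
      _ ≤ 2 * τ * (f x * Real.exp (-f x / (2 * τ))) :=
        mul_le_mul_of_nonneg_right (secondWeightedIdentity_mul_exp_le hτ (hf0 x)) h0
  refine ⟨iA, iA.mono ((hf.continuous.mul hSc).mul hE).aestronglyMeasurable
    (Eventually.of_forall fun x ↦ ?_)⟩
  rw [Real.norm_eq_abs, Real.norm_eq_abs,
    abs_of_nonneg (mul_nonneg (mul_nonneg (hf0 x) (hR0 x)) (Real.exp_pos _).le),
    abs_of_nonneg (mul_nonneg (sq_nonneg _) (Real.exp_pos _).le), sq]
  exact mul_le_mul_of_nonneg_right (mul_le_mul_of_nonneg_left (hRle x) (hf0 x)) (Real.exp_pos _).le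

end ProperIntegrability

/-! ## The integrated identities (n = 4) -/

section Integrated

variable {M : Type} [TopologicalSpace M] [T2Space M] [SecondCountableTopology M]
  [ChartedSpace (EuclideanSpace ℝ (Fin 4)) M] [IsManifold (𝓡 4) ∞ M] [ConnectedSpace M]
  [T3Space M] [MeasurableSpace M] [BorelSpace M]

/-- **The first weighted identity, split** (Wang–Wang 2023, (2.9)–(2.10), `n = 4`), over
`g.riemVolume`, on a complete connected normalised 4-d gradient shrinker, for `τ > 0`:
`∫ f e^{-f/τ} − 2τ ∫ e^{-f/τ} = (1 − τ) ∫ R e^{-f/τ}` — `weightedIdentity_riemVolume`, the three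
weights being integrable by `weightedIntegrability_riemVolume`. -/
theorem secondWeightedIdentity_firstIdentity
    (g : PseudoRiemannianMetric (𝓡 4) ∞ (EuclideanSpace ℝ (Fin 4)) (TangentSpace (𝓡 4) : M → Type _))
    [g.HasLeviCivita] (f : M → ℝ) (hg : g.IsRiemannian)
    (hc : ∀ (x : M) (r : NNReal), IsCompact {y : M | g.edist hg x y ≤ r})
    (hf : ContMDiff (𝓡 4) 𝓘(ℝ, ℝ) ∞ f)
    (hsol : ∀ (x : M) (X Y : TangentSpace (𝓡 4) x),
      g.ricci x X Y + g.hessian f x X Y = (1 / 2 : ℝ) * g.val x X Y)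
    (hnorm : ∀ x : M, g.scalarCurvature x + g.gradSq f x = f x) {τ : ℝ} (hτ : 0 < τ) :
    (∫ x, f x * Real.exp (-f x / τ) ∂g.riemVolume) - 2 * τ * ∫ x, Real.exp (-f x / τ) ∂g.riemVolume =
      (1 - τ) * ∫ x, g.scalarCurvature x * Real.exp (-f x / τ) ∂g.riemVolume := by
  obtain ⟨hR0, -, hprop⟩ :=
    NoncompactShrinkerGapCarrilloNiClauses.scalarCurvature_nonneg_and_isCompact_sublevel g f hg hc hf
      hsol hnorm
  obtain ⟨iZ, iF, iR⟩ := weightedIntegrability_riemVolume hg hf hsol hnorm hprop hR0 hτ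
  have h1 := weightedIdentity_riemVolume g f hg hc hf hsol hnorm hτ.ne' iZ iF iR
  have hsplit : ∀ x, (f x - 2 * τ) * Real.exp (-f x / τ) =
      f x * Real.exp (-f x / τ) - 2 * τ * Real.exp (-f x / τ) := fun x ↦ by ring
  simp_rw [hsplit] at h1
  rw [integral_sub iF (iZ.const_mul _), integral_const_mul] at h1
  exact h1

/-- **Wang–Wang 2023, second weighted identity, `n = 4`, over `g.riemVolume`**: on a complete
connected normalised 4-d gradient shrinker, for every `τ > 0`, the weights `f² e^{-f/τ}`,
`f R e^{-f/τ}` are integrable and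
`∫ f² e^{-f/τ} = 3τ ∫ f e^{-f/τ} + (1 − τ) ∫ f R e^{-f/τ} − τ ∫ R e^{-f/τ}`:
the cut-off Green identity `∫ Δ(f e^{-f/τ}) dV = 0` (`integral_dalembertian_eq_zero_of_proper`,
exhaustion `f`, proper by `scalarCurvature_nonneg_and_isCompact_sublevel`), the pointwise formula
`secondWeightedIdentity_dalembertian`, and the first identity `secondWeightedIdentity_firstIdentity`. -/
theorem secondWeightedIdentity_riemVolume
    (g : PseudoRiemannianMetric (𝓡 4) ∞ (EuclideanSpace ℝ (Fin 4)) (TangentSpace (𝓡 4) : M → Type _))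
    [g.HasLeviCivita] (f : M → ℝ) (hg : g.IsRiemannian)
    (hc : ∀ (x : M) (r : NNReal), IsCompact {y : M | g.edist hg x y ≤ r})
    (hf : ContMDiff (𝓡 4) 𝓘(ℝ, ℝ) ∞ f)
    (hsol : ∀ (x : M) (X Y : TangentSpace (𝓡 4) x),
      g.ricci x X Y + g.hessian f x X Y = (1 / 2 : ℝ) * g.val x X Y)
    (hnorm : ∀ x : M, g.scalarCurvature x + g.gradSq f x = f x) {τ : ℝ} (hτ : 0 < τ) :
    Integrable (fun x ↦ f x ^ 2 * Real.exp (-f x / τ)) g.riemVolume ∧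
      Integrable (fun x ↦ f x * g.scalarCurvature x * Real.exp (-f x / τ)) g.riemVolume ∧
      ∫ x, f x ^ 2 * Real.exp (-f x / τ) ∂g.riemVolume =
        3 * τ * (∫ x, f x * Real.exp (-f x / τ) ∂g.riemVolume) +
          (1 - τ) * (∫ x, f x * g.scalarCurvature x * Real.exp (-f x / τ) ∂g.riemVolume) -
          τ * (∫ x, g.scalarCurvature x * Real.exp (-f x / τ) ∂g.riemVolume) := by
  obtain ⟨hR0, -, hprop⟩ :=
    NoncompactShrinkerGapCarrilloNiClauses.scalarCurvature_nonneg_and_isCompact_sublevel g f hg hc hf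
      hsol hnorm
  obtain ⟨iZ, iF, iR⟩ := weightedIntegrability_riemVolume hg hf hsol hnorm hprop hR0 hτ
  obtain ⟨iF2, iFR⟩ := secondWeightedIdentity_integrable hg hf hsol hnorm hprop hR0 hτ
  refine ⟨iF2, iFR, ?_⟩
  have hτ0 : τ ≠ 0 := hτ.ne'
  have h1 := secondWeightedIdentity_firstIdentity g f hg hc hf hsol hnorm hτ
  -- the weight is `C²`
  have hw : ContMDiff (𝓡 4) 𝓘(ℝ, ℝ) 2 (fun y ↦ f y * Real.exp (-f y / τ)) :=
    ((contDiff_id.mul (Real.contDiff_exp.comp (contDiff_neg.div_const τ))).comp_contMDiff hf).of_le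
      ENat.LEInfty.out
  -- pointwise Laplacian of the weight, `n = 4`
  have hpt : ∀ x, g.dalembertian (fun y ↦ f y * Real.exp (-f y / τ)) x =
      (τ ^ 2)⁻¹ * (f x ^ 2 * Real.exp (-f x / τ) +
        (τ - 1) * (f x * g.scalarCurvature x * Real.exp (-f x / τ)) -
        4 * τ * (f x * Real.exp (-f x / τ)) +
        (2 * τ - τ ^ 2) * (g.scalarCurvature x * Real.exp (-f x / τ)) +
        2 * τ ^ 2 * Real.exp (-f x / τ)) := fun x ↦ by
    rw [secondWeightedIdentity_dalembertian hsol hnorm hf τ x]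
    simp only [Nat.cast_ofNat]
    field_simp
    ring
  -- integrability of the combination
  have iB : Integrable (fun x ↦ (τ - 1) * (f x * g.scalarCurvature x * Real.exp (-f x / τ)))
      g.riemVolume := iFR.const_mul _
  have iC : Integrable (fun x ↦ 4 * τ * (f x * Real.exp (-f x / τ))) g.riemVolume :=
    iF.const_mul _
  have iD : Integrable (fun x ↦ (2 * τ - τ ^ 2) * (g.scalarCurvature x * Real.exp (-f x / τ)))
      g.riemVolume := iR.const_mul _
  have iE : Integrable (fun x ↦ 2 * τ ^ 2 * Real.exp (-f x / τ)) g.riemVolume := iZ.const_mul _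
  have iAB : Integrable (fun x ↦ f x ^ 2 * Real.exp (-f x / τ) +
      (τ - 1) * (f x * g.scalarCurvature x * Real.exp (-f x / τ))) g.riemVolume := iF2.add iB
  have iABC : Integrable (fun x ↦ f x ^ 2 * Real.exp (-f x / τ) +
      (τ - 1) * (f x * g.scalarCurvature x * Real.exp (-f x / τ)) -
      4 * τ * (f x * Real.exp (-f x / τ))) g.riemVolume := iAB.sub iC
  have iABCD : Integrable (fun x ↦ f x ^ 2 * Real.exp (-f x / τ) +
      (τ - 1) * (f x * g.scalarCurvature x * Real.exp (-f x / τ)) -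
      4 * τ * (f x * Real.exp (-f x / τ)) +
      (2 * τ - τ ^ 2) * (g.scalarCurvature x * Real.exp (-f x / τ))) g.riemVolume := iABC.add iD
  have iAll : Integrable (fun x ↦ f x ^ 2 * Real.exp (-f x / τ) +
      (τ - 1) * (f x * g.scalarCurvature x * Real.exp (-f x / τ)) -
      4 * τ * (f x * Real.exp (-f x / τ)) +
      (2 * τ - τ ^ 2) * (g.scalarCurvature x * Real.exp (-f x / τ)) +
      2 * τ ^ 2 * Real.exp (-f x / τ)) g.riemVolume := iABCD.add iE
  -- `Δ(f e^{-f/τ})` is integrable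
  have hΔ : Integrable (fun x ↦ g.dalembertian (fun y ↦ f y * Real.exp (-f y / τ)) x)
      g.riemVolume :=
    (iAll.const_mul ((τ ^ 2)⁻¹)).congr (Eventually.of_forall fun x ↦ (hpt x).symm)
  -- `g⁻¹(df, d(f e^{-f/τ})) = e^{-f/τ} (1 − f/τ) (f − R)` is integrable
  have hcr : ∀ x, g.innerDual x (mvfderiv (𝓡 4) f x).toLinearMap
      (mvfderiv (𝓡 4) (fun y ↦ f y * Real.exp (-f y / τ)) x).toLinearMap =
      (f x * Real.exp (-f x / τ) - g.scalarCurvature x * Real.exp (-f x / τ)) -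
        τ⁻¹ * (f x ^ 2 * Real.exp (-f x / τ) -
          f x * g.scalarCurvature x * Real.exp (-f x / τ)) := fun x ↦ by
    rw [secondWeightedIdentity_innerDual_mvfderiv τ (hf.mdifferentiableAt (by norm_num))]
    have hgrad : g.innerDual x (mvfderiv (𝓡 4) f x).toLinearMap (mvfderiv (𝓡 4) f x).toLinearMap =
        g.gradSq f x := rfl
    rw [hgrad, show g.gradSq f x = f x - g.scalarCurvature x by linarith [hnorm x]]
    field_simp
  have iX : Integrable (fun x ↦ (f x * Real.exp (-f x / τ) -
      g.scalarCurvature x * Real.exp (-f x / τ)) -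
        τ⁻¹ * (f x ^ 2 * Real.exp (-f x / τ) -
          f x * g.scalarCurvature x * Real.exp (-f x / τ))) g.riemVolume :=
    (iF.sub iR).sub ((iF2.sub iFR).const_mul τ⁻¹)
  have hcross : Integrable (fun x ↦ g.innerDual x (mvfderiv (𝓡 4) f x).toLinearMap
      (mvfderiv (𝓡 4) (fun y ↦ f y * Real.exp (-f y / τ)) x).toLinearMap) g.riemVolume :=
    iX.congr (Eventually.of_forall fun x ↦ (hcr x).symm)
  have h0 := CarrilloNi2009_shrinkerLSI.integral_dalembertian_eq_zero_of_proper hg hf hprop hw hΔ hcross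
  simp_rw [hpt] at h0
  rw [integral_const_mul, mul_eq_zero] at h0
  have hτ2 : (τ ^ 2)⁻¹ ≠ 0 := by positivity
  rcases h0 with h0 | h0
  · exact absurd h0 hτ2
  rw [integral_add iABCD iE, integral_add iABC iD, integral_sub iAB iC, integral_add iF2 iB,
    integral_const_mul, integral_const_mul, integral_const_mul, integral_const_mul] at h0
  linear_combination h0 + τ * h1

end Integrated

/-! ## The registered helpers -/

/-- **Helper `helper_secondWeightedIdentity` of line `Sketch`** (Wang–Wang 2023, arXiv:2308.06560,
proof of Prop. 2.6, second moment, `n = 4`): on every complete connected normalised 4-d gradient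
shrinking Ricci soliton and for every `τ > 0`, the weights `f² e^{-f/τ}`, `f R e^{-f/τ}` are
integrable and `∫ f² e^{-f/τ} dV = 3τ ∫ f e^{-f/τ} dV + (1 − τ) ∫ f R e^{-f/τ} dV − τ ∫ R e^{-f/τ} dV`
(`dV` the Riemannian measure of `g.toContMDiffRiemannianMetric hg`, to which `g.riemVolume` unfolds
by `riemVolume_eq`): `secondWeightedIdentity_riemVolume`. -/
theorem helper_secondWeightedIdentity : ∀ (M : Type) [TopologicalSpace M] [T2Space M] [SecondCountableTopology M] [ChartedSpace (EuclideanSpace ℝ (Fin 4)) M] [IsManifold (𝓡 4) ∞ M] [ConnectedSpace M] [T3Space M] [MeasurableSpace M] [BorelSpace M] (g : Literature.Geometry.Lorentzian.PseudoRiemannianMetric (𝓡 4) ∞ (EuclideanSpace ℝ (Fin 4)) (TangentSpace (𝓡 4) : M → Type _)) [g.HasLeviCivita] (f : M → ℝ) (hg : g.IsRiemannian), (∀ (x : M) (r : NNReal), IsCompact {y : M | g.edist hg x y ≤ r}) → ContMDiff (𝓡 4) 𝓘(ℝ, ℝ) ∞ f → (∀ (x : M) (X Y : TangentSpace (𝓡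 4) x), g.ricci x X Y + g.hessian f x X Y = (1 / 2 : ℝ) * g.val x X Y) → (∀ x : M, g.scalarCurvature x + g.gradSq f x = f x) → ∀ τ : ℝ, 0 < τ → MeasureTheory.Integrable (fun x ↦ f x ^ 2 * Real.exp (-f x / τ)) (Literature.Geometry.Lorentzian.riemannianMeasure (g.toContMDiffRiemannianMetric hg)) ∧ MeasureTheory.Integrable (fun x ↦ f x * g.scalarCurvature x * Real.exp (-f x / τ)) (Literature.Geometry.Lorentzian.riemannianMeasure (g.toContMDiffRiemannianMetric hg)) ∧ ∫ x, f x ^ 2 * Real.exp (-f x / τ) ∂(Literature.Geometry.Lorentzian.riemannianMeasure (g.toContMDiffRiemannianMetric hg)) = 3 * τ * (∫ x, f x * Real.exp (-f x / τ) ∂(Literature.Geometry.Lorentzian.riemannianMeasure (g.toContMDiffRiemannianMetric hg))) + (1 - τ) * (∫ x, f x * g.scalarCurvature x * Real.exp (-f x / τ) ∂(Literature.Geometry.Lorentzian.riemannianMeasure (g.toContMDiffRiemannianMetric hg))) - τ * (∫ x, g.scalarCurvature x * Real.exp (-f x / τ) ∂(Literature.Geometry.Lorentzian.riemannianMeasure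 (g.toContMDiffRiemannianMetric hg))) := by
  intro M _ _ _ _ _ _ _ _ _ g _ f hg hc hf hsol hnorm τ hτ
  rw [← PseudoRiemannianMetric.riemVolume_eq hg]
  exact secondWeightedIdentity_riemVolume g f hg hc hf hsol hnorm hτ

/-- **Helper `helper_varianceIdentity` of line `Sketch`** (Wang–Wang 2023, arXiv:2308.06560, proof
of Prop. 2.6, `n = 4`): on every complete connected normalised 4-d gradient shrinking Ricci soliton
and for every `τ > 0`, with `Z = ∫ e^{-f/τ}`, `F₁ = ∫ f e^{-f/τ}`, `F₂ = ∫ f² e^{-f/τ}`,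
`R₁ = ∫ R e^{-f/τ}`, `FR = ∫ f R e^{-f/τ}` (all `dV`),
`Z F₂ − F₁² = 2τ² Z² − τ² R₁ Z + (1 − τ)(Z FR − F₁ R₁)`: the linear combination
`Z · (second identity) + (τ Z − F₁) · (first identity)` of `secondWeightedIdentity_riemVolume` and
`secondWeightedIdentity_firstIdentity`. -/
theorem helper_varianceIdentity : ∀ (M : Type) [TopologicalSpace M] [T2Space M] [SecondCountableTopology M] [ChartedSpace (EuclideanSpace ℝ (Fin 4)) M] [IsManifold (𝓡 4) ∞ M] [ConnectedSpace M] [T3Space M] [MeasurableSpace M] [BorelSpace M] (g : Literature.Geometry.Lorentzian.PseudoRiemannianMetric (𝓡 4) ∞ (EuclideanSpace ℝ (Fin 4)) (TangentSpace (𝓡 4) : M → Type _)) [g.HasLeviCivita] (f : M → ℝ) (hg : g.IsRiemannian), (∀ (x : M) (r : NNReal), IsCompact {y : M | g.edist hg x y ≤ r}) → ContMDiff (𝓡 4) 𝓘(ℝ, ℝ) ∞ f → (∀ (x : M) (X Y : TangentSpace (𝓡 4) x), g.ricci x X Y + g.hessian f x X Y = (1 / 2 : ℝ) * g.val x X Y)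 → (∀ x : M, g.scalarCurvature x + g.gradSq f x = f x) → ∀ τ : ℝ, 0 < τ → (∫ x, Real.exp (-f x / τ) ∂(Literature.Geometry.Lorentzian.riemannianMeasure (g.toContMDiffRiemannianMetric hg))) * (∫ x, f x ^ 2 * Real.exp (-f x / τ) ∂(Literature.Geometry.Lorentzian.riemannianMeasure (g.toContMDiffRiemannianMetric hg))) - (∫ x, f x * Real.exp (-f x / τ) ∂(Literature.Geometry.Lorentzian.riemannianMeasure (g.toContMDiffRiemannianMetric hg))) ^ 2 = 2 * τ ^ 2 * (∫ x, Real.exp (-f x / τ) ∂(Literature.Geometry.Lorentzian.riemannianMeasure (g.toContMDiffRiemannianMetric hg))) ^ 2 - τ ^ 2 * (∫ x, g.scalarCurvature x * Real.exp (-f x / τ) ∂(Literature.Geometry.Lorentzian.riemannianMeasure (g.toContMDiffRiemannianMetric hg))) * (∫ x, Real.exp (-f x / τ) ∂(Literature.Geometry.Lorentzian.riemannianMeasure (g.toContMDiffRiemannianMetric hg))) + (1 - τ) * ((∫ x, Real.exp (-f x / τ) ∂(Literature.Geometry.Lorentzian.riemannianMeasure (g.toContMDiffRiemannianMetric hg)))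 * (∫ x, f x * g.scalarCurvature x * Real.exp (-f x / τ) ∂(Literature.Geometry.Lorentzian.riemannianMeasure (g.toContMDiffRiemannianMetric hg))) - (∫ x, f x * Real.exp (-f x / τ) ∂(Literature.Geometry.Lorentzian.riemannianMeasure (g.toContMDiffRiemannianMetric hg))) * (∫ x, g.scalarCurvature x * Real.exp (-f x / τ) ∂(Literature.Geometry.Lorentzian.riemannianMeasure (g.toContMDiffRiemannianMetric hg)))) := by
  intro M _ _ _ _ _ _ _ _ _ g _ f hg hc hf hsol hnorm τ hτ
  rw [← PseudoRiemannianMetric.riemVolume_eq hg]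
  have h1 := secondWeightedIdentity_firstIdentity g f hg hc hf hsol hnorm hτ
  obtain ⟨-, -, h2⟩ := secondWeightedIdentity_riemVolume g f hg hc hf hsol hnorm hτ
  linear_combination (∫ x, Real.exp (-f x / τ) ∂g.riemVolume) * h2 +
    (τ * (∫ x, Real.exp (-f x / τ) ∂g.riemVolume) - ∫ x, f x * Real.exp (-f x / τ) ∂g.riemVolume) * h1

end Summit.SmoothPoincare4.SmoothPoincare4.Theorems.ConicalGapSketch

end
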